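import Summits.Parity.GeneralizedHardyLittlewood.Theorems.FordMaynardSieveConst01651SieveConst01651SignClauseFive
import HarnessLib

/-!
# Route `FordMaynardSieveConst01651`, target `SieveConst01651` (stmt-Parity-19185), stub `stub_coneCertClosed`,
# residue `h5`: evaluation of one complementary couple at a generic point

Def-free helper file.  After `…SignClauseFive.coneCert_five_le_couples` the residual dimension-5 sign check reads
`−4 + ∑_{|A|=2} (coneCert₂(x_A) + coneCert₃(x_{Aᶜ})) ≤ 0`.  At a GENERIC point (all coordinates in open small cells, no
pair sum on a band line `c₀` or `1/2`) each couple is ONE table lookup (`couple_eval_generic`):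

* if `|x_A| < 1/2`: the pair reads `g2Lookup (cellIdx x_{i₀}) (cellIdx x_{i₁}) (bandIdx |x_A|) / 10⁶` and the triple vanishes;
* if `|x_A| > 1/2`: the pair vanishes and the triple reads `g3Lookup` of the three complementary cells `/ 10⁶`;

(`i₀ < i₁` the elements of `A`, `j₀ < j₁ < j₂` those of `Aᶜ`, all via `orderEmbOfFin`).  With the Farkas certificates of the
`1 104` violated-but-empty dimension-5 types (item evidence, exact rationals) this is the complete specification of the
`--computational` checker that would discharge `h5`.

References: [FordMaynard2024PrimeSieves] arXiv:2407.14368, Theorem 7.3 (a), §8.2.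
-/

noncomputable section

open Finset
open scoped Classical
open Literature.NumberTheory.Sieve Literature.NumberTheory.Sieve.FordMaynard

namespace Summit.Parity.GeneralizedHardyLittlewood.FordMaynardSieveConst01651SieveConst01651

/-- **One couple at a generic point.** Let `x ∈ ℝ⁵` be monotone with `|x| = 1`, every coordinate in an open
small cell and no pair sum equal to `c₀ = 8349/20000` or `1/2`.  For `|A| = 2` with increasing enumerations `e = A.orderEmbOfFin`,
`f = Aᶜ.orderEmbOfFin`:
`coneCert₂(x_A) + coneCert₃(x_{Aᶜ}) = if x(e 0) + x(e 1) < 1/2 then g2Lookup … / 10⁶ else g3Lookup … / 10⁶`.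
[cite: FordMaynard2024PrimeSieves, Theorem 7.3 (a), §8.2] -/
theorem couple_eval_generic (x : Fin 5 → ℝ) (hx : Monotone x)
    (hsum : ∑ i, x i = 1) (hopen : ∀ i, x i ∈ openSmall)
    (hpair : ∀ i j, i < j → x i + x j ≠ 8349 / 20000 ∧ x i + x j ≠ 1 / 2)
    (A : Finset (Fin 5)) (hA : A.card = 2) (hAc : Aᶜ.card = 3) :
    coneCert 2 (fun i => x (A.orderEmbOfFin hA i)) + coneCert 3 (fun i => x (Aᶜ.orderEmbOfFin hAc i)) =
      if x (A.orderEmbOfFin hA 0) + x (A.orderEmbOfFin hA 1) < 1 / 2 then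
        ((g2Lookup (cellIdx (x (A.orderEmbOfFin hA 0))) (cellIdx (x (A.orderEmbOfFin hA 1)))
            (bandIdx (x (A.orderEmbOfFin hA 0) + x (A.orderEmbOfFin hA 1))) : ℤ) : ℝ) / 1000000
      else
        ((g3Lookup (cellIdx (x (Aᶜ.orderEmbOfFin hAc 0))) (cellIdx (x (Aᶜ.orderEmbOfFin hAc 1)))
            (cellIdx (x (Aᶜ.orderEmbOfFin hAc 2))) : ℤ) : ℝ) / 1000000 := by
  set e := A.orderEmbOfFin hA with he
  set f := Aᶜ.orderEmbOfFin hAc with hf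
  set y : Fin 2 → ℝ := fun i => x (e i) with hy
  set z : Fin 3 → ℝ := fun i => x (f i) with hz
  have hym : Monotone y := hx.comp e.monotone
  have hzm : Monotone z := hx.comp f.monotone
  have hsy : ∑ i, y i = ∑ i ∈ A, x i := sum_orderEmb_eq x A hA
  have hsz : ∑ i, z i = ∑ i ∈ Aᶜ, x i := sum_orderEmb_eq x Aᶜ hAc
  have hsc : ∑ i ∈ A, x i + ∑ i ∈ Aᶜ, x i = 1 := by rw [Finset.sum_add_sum_compl, hsum]
  have hy2 : ∑ i, y i = y 0 + y 1 := Fin.sum_univ_two y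
  have he01 : e 0 < e 1 := e.strictMono (by decide)
  -- pair sums of distinct increasing indices are off the band lines
  have hpair' : ∀ {i j : Fin 5}, i < j → x i + x j ≠ 8349 / 20000 ∧ x i + x j ≠ 1 / 2 := fun h => hpair _ _ h
  by_cases hlt : y 0 + y 1 < 1 / 2
  · -- the pair is live, the triple vanishes
    rw [if_pos hlt]
    have h2 : coneCert 2 y = ((g2Lookup (cellIdx (y 0)) (cellIdx (y 1)) (bandIdx (y 0 + y 1)) : ℤ) : ℝ) / 1000000 :=
      coneCert_two_eq_lookup y (hym (by decide)) (hopen _) (hopen _) (hpair' he01).1 hlt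
    have h3 : coneCert 3 z = 0 :=
      coneCert_three_eq_zero_of_half_lt z hzm (by rw [hsz]; linarith [hsy.symm.trans hy2 ▸ hlt, hsy, hy2])
    rw [h2, h3, add_zero]
  · push Not at hlt
    have hgt : 1 / 2 < y 0 + y 1 := lt_of_le_of_ne hlt (fun h => (hpair' he01).2 h.symm)
    rw [if_neg (not_lt.2 hlt)]
    have h2 : coneCert 2 y = 0 := coneCert_two_eq_zero_of_half_lt y hym hgt
    have hz3 : ∑ i, z i < 1 / 2 := by rw [hsz]; linarith [hsy, hy2]
    have hf01 : f 0 < f 1 := f.strictMono (by decide)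
    have hf12 : f 1 < f 2 := f.strictMono (by decide)
    have hf02 : f 0 < f 2 := f.strictMono (by decide)
    have h3 : coneCert 3 z = ((g3Lookup (cellIdx (z 0)) (cellIdx (z 1)) (cellIdx (z 2)) : ℤ) : ℝ) / 1000000 := by
      refine coneCert_three_eq_lookup z hzm (fun i => hopen _) (fun i j hij => ?_) hz3
      fin_cases i <;> fin_cases j
      · exact absurd hij (lt_irrefl _)
      · exact hpair' hf01
      · exact hpair' hf02
      · exact absurd hij (by decide)
      · exact absurd hij (lt_irrefl _)
      · exact hpair' hf12
      · exact absurd hij (by decide)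
      · exact absurd hij (by decide)
      · exact absurd hij (lt_irrefl _)
    rw [h2, h3, zero_add]

end Summit.Parity.GeneralizedHardyLittlewood.FordMaynardSieveConst01651SieveConst01651

end
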